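import Mathlib
import HarnessLib
import Summits.HubbardSuperconductivity.HubbardSuperconductivity.Theorems.KLProgrammeKLRegimeBetaSplitV7

/-!
# Route `KLProgramme` — crux K3, child 1 `KLRegimeBetaSplit` at CLAUSE level: `BetaSplitP Pr W` for every bundle whose split slot is implied by
# `BetaSplitAtS2` and whose engine slot yields the FOUR clauses child 1 actually reads — `PairLadderStepAtV5`, `PairValueIncrementAtV5`,
# `EngineFirstMoments`, `IsoTupleL1AtS` — so that re-stagings of the other engine conjuncts (E0/E1/(E2′)/UV) never touch child 1 again

Cell gate-hubbard-kl, seat hubbard-kl-r2d-p1 (child-1 owner).  Robustness twin of `…KLRegimeBetaSplitV7` (`betaSplitP_of_slotsS2` /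
`betaSplitP_klPredsV7`): the bundle went V3 → V7 in one afternoon, each time through an engine or two-leg conjunct child 1 does not read.
**`pairArrayAtV2_of_pairClauses_explicit`** (row 0′ from the two pair clauses, constants as in `…SplitPairArrayV5`), **`betaSplitP_of_clauses`**
(the child-1 theorem with the engine hypothesis weakened to the four clauses; p1b's `betaSplitAtS2_of_pairArrayAtV2` for the step), (the V7 instance is
`betaSplitP_klPredsV7` of `…KLRegimeBetaSplitV7`; a later bundle instantiates `betaSplitP_of_clauses` with two projections).  Everything is proved; no definitions.
-/

noncomputable section

namespace Summit.HubbardSuperconductivity.HubbardSuperconductivity.Theorems.KLRegimeSplit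

set_option linter.dupNamespace false -- summit = problem name (single-conjunct summit), D-0017

open Real Finset Literature.MathematicalPhysics.QuantumLattice Literature.Probability.LatticeModels
open Summit.HubbardSuperconductivity.HubbardSuperconductivity.Theorems.KLProgrammeLegKernels
open Summit.HubbardSuperconductivity.HubbardSuperconductivity.Theorems.CooperChannelRiccatiFlow
open Summit.HubbardSuperconductivity.HubbardSuperconductivity.Theorems.DispersionFlow

section Model

variable (L M : ℕ) [NeZero L] [NeZero M]

variable {G : GeoConsts} {P : SplitConsts} {Qc : EngConsts}

/-- **Packaging from the two pair clauses** (`pairArray_envelope_v5` + the tolerance line): the clause-level twin of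
`pairArrayAtV2_of_engineBoundsV5S`. -/
theorem pairArrayAtV2_of_pairClauses (hG : G.WF) (hP : P.WF) (hQc : Qc.WF) {β U μ : ℝ} {K : TrigPolyC4v} (hU : 0 ≤ U)
    (hU1 : |U| ≤ 1) {n : ℕ} (hn : n ≤ nScales β) (hsteps : ∀ j ≤ n, PairLadderStepAtV5 L M G P Qc β U μ K j)
    (hincr : ∀ j, 1 ≤ j → j ≤ n → PairValueIncrementAtV5 L M G P Qc β U μ K j)
    (hsmall : 8 * 20 * ((initDevBar G U + ∑ j ∈ range n, (drivePBar G P U j + eremBar G P Qc U β L j) +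
        (4 / 3 * (G.CF * (P.Klam * U) ^ 2) + 40 * (Qc.CR * P.Klam ^ 3 * U ^ 2))) +
        (∑ j ∈ range n, (drivePBar G P U j + eremBar G P Qc U β L j) +
          (G.CF * (P.Klam * U) ^ 2 + 8 * (Qc.CR * P.Klam ^ 3 * U ^ 2)))) * (G.bhi * n) ≤ 1)
    (hCW : 8 * ((initDevBar G U + ∑ j ∈ range n, (drivePBar G P U j + eremBar G P Qc U β L j) +
            (4 / 3 * (G.CF * (P.Klam * U) ^ 2) + 40 * (Qc.CR * P.Klam ^ 3 * U ^ 2))) +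
          (∑ j ∈ range n, (drivePBar G P U j + eremBar G P Qc U β L j) +
            (G.CF * (P.Klam * U) ^ 2 + 8 * (Qc.CR * P.Klam ^ 3 * U ^ 2)))) +
        ((P.Klam * U) ^ 2 * (3 * G.CF) + (4 / 3 * (G.CF * (P.Klam * U) ^ 2) + 40 * (Qc.CR * P.Klam ^ 3 * U ^ 2)) +
          ∑ i ∈ range n, eremBar G P Qc U β L i) ≤ (P.C_W + klLegKappa * Qc.CR * P.Klam ^ 3) * U ^ 2) :
    PairArrayAtV2 L M P Qc β U μ K n := by
  intro Qm
  obtain ⟨u, hu0, huU, hu⟩ := pairArray_envelope_v5 L M hG hP hQc hU hU1 hn hsteps hincr Qm hsmall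
  exact ⟨u, hu0, huU.trans (by rw [abs_of_nonneg hU]; linarith), fun k hk k' hk' => (hu k hk k' hk').trans hCW⟩

set_option maxHeartbeats 400000 in
/-- **Row 0′ with the constants chosen, from the two pair CLAUSES only** (`PairLadderStepAtV5` at `j ≤ n`, `PairValueIncrementAtV5` at
`1 ≤ j ≤ n`) — the engine-slot version `pairArrayAtV2_of_engineBoundsV5S_explicit` reads them off `EngineBoundsAtV5S`; this one survives any
re-staging of the OTHER engine conjuncts.  With `C := 8(Σ_χ(abot+atop)+1) + 17(aplus Klam² Z + cloc Klam²(1−4^{-θ})⁻¹ + 1) + 1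
+ 23·CF·Klam² ≤ P.C_W` (the `Q.CR·Klam³` part, `≤ 424`, is below `klLegKappa = 4000`), `2·CR·Klam³·|U| ≤ 1`, `|U| ≤ 1`, the volume line
`17·Σ_{j<n} CL β j/L ≤ U²` and the NO-ONSET line `160·((Σ_χ(abot+atop)+1) + 2(aplus Klam² Z + cloc Klam²(1−4^{-θ})⁻¹ + 1) + 1 + 3·CF·Klam² +
48·CR·Klam³)·U²·(bhi·n) ≤ 1`, the engine bounds at the scales `≤ n ≤ n_β` give `PairArrayAtV2 L M P Q β U μ K n`. -/
theorem pairArrayAtV2_of_pairClauses_explicit (hG : G.WF) (hP : P.WF) (hQc : Qc.WF) {β U μ : ℝ} {K : TrigPolyC4v}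
    (hU : 0 ≤ U) (hU1 : |U| ≤ 1) {n : ℕ} (hn : n ≤ nScales β) (hsteps : ∀ j ≤ n, PairLadderStepAtV5 L M G P Qc β U μ K j)
    (hincr : ∀ j, 1 ≤ j → j ≤ n → PairValueIncrementAtV5 L M G P Qc β U μ K j)
    (hUCR : 2 * Qc.CR * P.Klam ^ 3 * |U| ≤ 1) (hL : 17 * ∑ j ∈ range n, Qc.CL β j / L ≤ U ^ 2)
    (hsmall : 8 * 20 * (((∑ χ : D4Irrep, (G.abot χ + G.atop χ) + 1) +
        2 * (G.aplus * P.Klam ^ 2 * G.Z + G.cloc * P.Klam ^ 2 * (1 - (4 : ℝ) ^ (-G.θ))⁻¹ + 1) + 1 +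
          3 * (G.CF * P.Klam ^ 2) + 48 * (Qc.CR * P.Klam ^ 3)) * U ^ 2) * (G.bhi * n) ≤ 1)
    (hCW : 8 * (∑ χ : D4Irrep, (G.abot χ + G.atop χ) + 1) +
        17 * (G.aplus * P.Klam ^ 2 * G.Z + G.cloc * P.Klam ^ 2 * (1 - (4 : ℝ) ^ (-G.θ))⁻¹ + 1) + 1 +
          23 * (G.CF * P.Klam ^ 2) ≤ P.C_W) :
    PairArrayAtV2 L M P Qc β U μ K n := by
  have hdrive := drivePBar_sum_le (P := P) hG U n
  have herem := eremBar_sum_le hG hP hQc U β L n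
  have hU2 : 0 ≤ U ^ 2 := sq_nonneg U
  have hCL0 : 0 ≤ ∑ j ∈ range n, Qc.CL β j / L := sum_nonneg fun j _ => div_nonneg (hQc.2.2.2.2.2.2.2 β j) (Nat.cast_nonneg L)
  have hθ : 0 < G.θ := hG.2.2.2.2.2.1
  have hg : 0 ≤ (1 - (4 : ℝ) ^ (-G.θ))⁻¹ :=
    inv_nonneg.2 (by have := Real.rpow_lt_one_of_one_lt_of_neg (x := (4 : ℝ)) (by norm_num) (by linarith : -G.θ < 0); linarith)
  have hK0 : 0 ≤ P.Klam := zero_le_one.trans hP.1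
  have hcloc : 0 ≤ G.cloc := hG.2.2.2.2.1
  have haplus : 0 ≤ G.aplus := hG.2.2.2.2.2.2.2.2.2.2.1
  have hCF : 0 ≤ G.CF := hG.2.2.2.2.2.2.2.2.2.2.2.2.2.1
  have hCR : 0 ≤ Qc.CR := hQc.2.1
  have hbhi : 0 ≤ G.bhi := hG.2.2.1.trans hG.2.2.2.1
  have hab : 0 ≤ ∑ χ : D4Irrep, (G.abot χ + G.atop χ) := sum_nonneg fun χ _ => add_nonneg (hG.2.1 χ) (hG.1 χ)
  have hK2 : 0 ≤ P.Klam ^ 2 * U ^ 2 := by positivity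
  have hK3 : 0 ≤ Qc.CR * P.Klam ^ 3 * U ^ 2 := by positivity
  have hZ : 0 ≤ G.Z := le_trans (sum_nonneg fun j _ => hG.2.2.2.2.2.2.2.2.1 j) (hG.2.2.2.2.2.2.2.2.2.1 0)
  have hCRU : 2 * Qc.CR * P.Klam ^ 3 * |U| * U ^ 2 ≤ U ^ 2 := by nlinarith
  have hS : ∑ j ∈ range n, (drivePBar G P U j + eremBar G P Qc U β L j) ≤
      (G.aplus * P.Klam ^ 2 * G.Z + G.cloc * P.Klam ^ 2 * (1 - (4 : ℝ) ^ (-G.θ))⁻¹ + 2 * Qc.CR * P.Klam ^ 3 * |U|) * U ^ 2 +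
        ∑ j ∈ range n, Qc.CL β j / L := by
    rw [sum_add_distrib]; nlinarith [hdrive, herem]
  have hS0 : 0 ≤ ∑ j ∈ range n, (drivePBar G P U j + eremBar G P Qc U β L j) :=
    sum_nonneg fun j _ => add_nonneg (drivePBar_nonneg' hG U j) (eremBar_nonneg' hG hP hQc U β L j)
  have hinit : initDevBar G U = (∑ χ : D4Irrep, (G.abot χ + G.atop χ) + 1) * U ^ 2 := rfl
  have hn0 : (0 : ℝ) ≤ n := Nat.cast_nonneg n
  have hSe0 : 0 ≤ ∑ i ∈ range n, eremBar G P Qc U β L i := sum_nonneg fun i _ => eremBar_nonneg' hG hP hQc U β L i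
  have hκ : klLegKappa = 4000 := rfl
  refine pairArrayAtV2_of_pairClauses L M hG hP hQc hU hU1 hn hsteps hincr ?_ ?_
  · refine le_trans ?_ hsmall
    have hmain : (initDevBar G U + ∑ j ∈ range n, (drivePBar G P U j + eremBar G P Qc U β L j) +
        (4 / 3 * (G.CF * (P.Klam * U) ^ 2) + 40 * (Qc.CR * P.Klam ^ 3 * U ^ 2))) +
        (∑ j ∈ range n, (drivePBar G P U j + eremBar G P Qc U β L j) +
          (G.CF * (P.Klam * U) ^ 2 + 8 * (Qc.CR * P.Klam ^ 3 * U ^ 2))) ≤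
        ((∑ χ : D4Irrep, (G.abot χ + G.atop χ) + 1) +
          2 * (G.aplus * P.Klam ^ 2 * G.Z + G.cloc * P.Klam ^ 2 * (1 - (4 : ℝ) ^ (-G.θ))⁻¹ + 1) + 1 +
            3 * (G.CF * P.Klam ^ 2) + 48 * (Qc.CR * P.Klam ^ 3)) * U ^ 2 := by
      rw [hinit]; nlinarith [hS, hCRU, hL, hCL0, mul_nonneg hCF hK2]
    have h0 : 0 ≤ (initDevBar G U + ∑ j ∈ range n, (drivePBar G P U j + eremBar G P Qc U β L j) +
        (4 / 3 * (G.CF * (P.Klam * U) ^ 2) + 40 * (Qc.CR * P.Klam ^ 3 * U ^ 2))) +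
        (∑ j ∈ range n, (drivePBar G P U j + eremBar G P Qc U β L j) +
          (G.CF * (P.Klam * U) ^ 2 + 8 * (Qc.CR * P.Klam ^ 3 * U ^ 2))) := by
      rw [hinit]; positivity
    exact mul_le_mul_of_nonneg_right (mul_le_mul_of_nonneg_left hmain (by norm_num)) (mul_nonneg hbhi hn0)
  · rw [hκ]
    have herem' : ∑ i ∈ range n, eremBar G P Qc U β L i ≤
        (G.cloc * P.Klam ^ 2 * (1 - (4 : ℝ) ^ (-G.θ))⁻¹ + 2 * Qc.CR * P.Klam ^ 3 * |U|) * U ^ 2 +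
          ∑ j ∈ range n, Qc.CL β j / L := herem
    -- the `Σ(drivePBar + ē)`-type terms: `16·S + Σē ≤ (17(aKZ + cKg) + 18)·U²`
    have hT1 : 16 * ∑ j ∈ range n, (drivePBar G P U j + eremBar G P Qc U β L j) + ∑ i ∈ range n, eremBar G P Qc U β L i ≤
        (17 * (G.aplus * P.Klam ^ 2 * G.Z + G.cloc * P.Klam ^ 2 * (1 - (4 : ℝ) ^ (-G.θ))⁻¹) + 18) * U ^ 2 := by
      nlinarith [hS, herem', hCRU, hL, hCL0, mul_nonneg haplus (mul_nonneg hK2 hZ)]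
    have hg2 : (P.Klam * U) ^ 2 = P.Klam ^ 2 * U ^ 2 := by ring
    have hCWU := mul_le_mul_of_nonneg_right hCW hU2
    rw [hinit, hg2]
    linarith [hT1, hCWU, hK3]

end Model

/-! ## The child-1 theorem at clause level -/

/-- **Child 1 at clause level, for every bundle and window.**  If the bundle's split slot is implied by `BetaSplitAtS2` and its engine slot
yields `PairLadderStepAtV5 ∧ PairValueIncrementAtV5 ∧ EngineFirstMoments ∧ IsoTupleL1AtS`, then `BetaSplitP Pr W`. -/
theorem betaSplitP_of_clauses {Pr : Preds} {W : Set ℝ}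
    (hs : ∀ (L M : ℕ) [NeZero L] [NeZero M] (G : GeoConsts) (P : SplitConsts) (Q : EngConsts) (β U μ : ℝ) (K : TrigPolyC4v) (n : ℕ),
      BetaSplitAtS2 L M G P Q β U μ K n → Pr.split L M G P Q β U μ K n)
    (he : ∀ (L M : ℕ) [NeZero L] [NeZero M] (G : GeoConsts) (P : SplitConsts) (Q : EngConsts) (β U μ : ℝ) (K : TrigPolyC4v) (n : ℕ),
      Pr.engine L M G P Q β U μ K n → PairLadderStepAtV5 L M G P Q β U μ K n ∧ PairValueIncrementAtV5 L M G P Q β U μ K n ∧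
        EngineFirstMoments L M G P Q β U μ K n ∧ IsoTupleL1AtS L M G P β U μ K n) :
    BetaSplitP Pr W := by
  intro G hG
  -- nonnegativity of the `G`-constants
  have hCF : 0 ≤ G.CF := hG.2.2.2.2.2.2.2.2.2.2.2.2.2.1
  have hcloc : 0 ≤ G.cloc := hG.2.2.2.2.1
  have haplus : 0 ≤ G.aplus := hG.2.2.2.2.2.2.2.2.2.2.1
  have hθ : 0 < G.θ := hG.2.2.2.2.2.1
  have hbhi : 0 ≤ G.bhi := le_trans hG.2.2.1 hG.2.2.2.1
  have hcE4 : 0 ≤ G.cE4 := hG.2.2.2.2.2.2.2.2.2.2.2.2.2.2.2.2.1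
  have hZ : 0 ≤ G.Z := le_trans (sum_nonneg fun j _ => hG.2.2.2.2.2.2.2.2.1 j) (hG.2.2.2.2.2.2.2.2.2.1 0)
  have hab : 0 ≤ ∑ χ : D4Irrep, (G.abot χ + G.atop χ) := sum_nonneg fun χ _ => add_nonneg (hG.2.1 χ) (hG.1 χ)
  have hg : 0 ≤ (1 - (4 : ℝ) ^ (-G.θ))⁻¹ :=
    inv_nonneg.2 (by have := Real.rpow_lt_one_of_one_lt_of_neg (x := (4 : ℝ)) (by norm_num) (by linarith : -G.θ < 0); linarith)
  -- the induction constants `P` (kept opaque)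
  obtain ⟨Klam, hKlam⟩ : ∃ x : ℝ, x = 2 * G.CF + 3 := ⟨_, rfl⟩
  have hKlam1 : 1 ≤ Klam := by rw [hKlam]; linarith
  have hKlam0 : 0 ≤ Klam := zero_le_one.trans hKlam1
  have hK2 : 0 ≤ Klam ^ 2 := sq_nonneg _
  have hx1 : 0 ≤ G.aplus * Klam ^ 2 * G.Z := mul_nonneg (mul_nonneg haplus hK2) hZ
  have hx2 : 0 ≤ G.cloc * Klam ^ 2 * (1 - (4 : ℝ) ^ (-G.θ))⁻¹ := mul_nonneg (mul_nonneg hcloc hK2) hg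
  obtain ⟨CW, hCW⟩ : ∃ x : ℝ, x = 8 * (∑ χ : D4Irrep, (G.abot χ + G.atop χ) + 1) +
      17 * (G.aplus * Klam ^ 2 * G.Z + G.cloc * Klam ^ 2 * (1 - (4 : ℝ) ^ (-G.θ))⁻¹ + 1) + 1 + 23 * (G.CF * Klam ^ 2) := ⟨_, rfl⟩
  have hCW0 : 0 ≤ CW := by rw [hCW]; positivity
  refine ⟨⟨Klam, CW, G.cE4 + 1, 0⟩, ⟨hKlam1, hCW0, by positivity⟩, ?_⟩
  intro Q hQ
  have hPWF : (⟨Klam, CW, G.cE4 + 1, 0⟩ : SplitConsts).WF := ⟨hKlam1, hCW0, by positivity⟩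
  have hCR : 0 ≤ Q.CR := hQ.2.1
  have hQcE4 : 0 ≤ Q.cE4 := hQ.2.2.2.1
  have hCL : ∀ β n, 0 ≤ Q.CL β n := hQ.2.2.2.2.2.2.2
  -- the no-onset constant `c₀` (after `Q`: it reads `Q.CR`)
  obtain ⟨Crow, hCrow_def⟩ : ∃ x : ℝ, x = (∑ χ : D4Irrep, (G.abot χ + G.atop χ) + 1) +
      2 * (G.aplus * Klam ^ 2 * G.Z + G.cloc * Klam ^ 2 * (1 - (4 : ℝ) ^ (-G.θ))⁻¹ + 1) + 1 + 3 * (G.CF * Klam ^ 2) +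
        48 * (Q.CR * Klam ^ 3) := ⟨_, rfl⟩
  have hK3 : 0 ≤ Q.CR * Klam ^ 3 := by positivity
  have hCrow1 : 1 ≤ Crow := by rw [hCrow_def]; nlinarith [mul_nonneg hCF hK2]
  have hCrow : 0 ≤ Crow := zero_le_one.trans hCrow1
  have hlog4 : 0 < Real.log 4 := Real.log_pos (by norm_num)
  refine ⟨Real.log 4 / (160 * Crow * (G.bhi + 1)), by positivity, ?_⟩
  intro c hc hcc₀ R hR
  -- `U₀`
  obtain ⟨CW', hCW'_def⟩ : ∃ x : ℝ, x = CW + klLegKappa * Q.CR * Klam ^ 3 := ⟨_, rfl⟩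
  have hκ0 : 0 ≤ klLegKappa := by unfold klLegKappa; norm_num
  have hCW'0 : 0 ≤ CW' := by
    rw [hCW'_def]; exact add_nonneg hCW0 (mul_nonneg (mul_nonneg hκ0 hCR) (pow_nonneg hKlam0 3))
  obtain ⟨Dval, hDval_def⟩ : ∃ x : ℝ, x = CW' + G.CF * CW' + G.CF * Klam ^ 2 := ⟨_, rfl⟩
  have hDval : 0 ≤ Dval := by
    rw [hDval_def]; exact add_nonneg (add_nonneg hCW'0 (mul_nonneg hCF hCW'0)) (mul_nonneg hCF hK2)
  obtain ⟨U₀, hU₀_def⟩ : ∃ x : ℝ, x = min 1 (min (1 / (2 * Q.CR * Klam ^ 3 + 1)) (min (1 / (Q.cE4 + 1)) (1 / (Dval + 1)))) :=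
    ⟨_, rfl⟩
  have hU₀ : 0 < U₀ := by
    rw [hU₀_def]
    exact lt_min one_pos (lt_min (by positivity) (lt_min (by positivity) (by positivity)))
  refine ⟨U₀, hU₀, fun β U => ⌈17 * (∑ j ∈ range (nScales β + 1), Q.CL β j) / U ^ 2⌉₊, fun _ _ _ => 0, ?_⟩
  intro μ hμ U hU hUle β hβmin hβc K hK L M _ _ hL hM n hn hKL hHist hE hT
  -- the smallness lines out of `U ≤ U₀`
  rw [hU₀_def] at hUle
  have hU1 : U ≤ 1 := hUle.trans (min_le_left _ _)
  have hUa : |U| = U := abs_of_pos hU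
  have hUa1 : |U| ≤ 1 := by rw [hUa]; exact hU1
  have hUCR : 2 * Q.CR * Klam ^ 3 * |U| ≤ 1 := by
    rw [hUa]
    exact klbs_mul_le_one_of_le_inv (by positivity) hU.le (hUle.trans ((min_le_right _ _).trans (min_le_left _ _)))
  have hUcE4 : Q.cE4 * |U| ≤ 1 := by
    rw [hUa]
    exact klbs_mul_le_one_of_le_inv hQcE4 hU.le
      (hUle.trans ((min_le_right _ _).trans ((min_le_right _ _).trans (min_le_left _ _))))
  have hUD : Dval * U ≤ 1 :=
    klbs_mul_le_one_of_le_inv hDval hU.le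
      (hUle.trans ((min_le_right _ _).trans ((min_le_right _ _).trans (min_le_right _ _))))
  have hc' : 160 * Crow * (G.bhi + 1) * c ≤ Real.log 4 := by
    have hpos : 0 < 160 * Crow * (G.bhi + 1) := by positivity
    have := (le_div_iff₀ hpos).1 hcc₀
    linarith
  -- the engine bounds at every scale `j ≤ n` (history + the scale-`n` hypothesis)
  have hEn := he L M G _ Q β U μ K n hE
  have hEall : ∀ j ≤ n, PairLadderStepAtV5 L M G ⟨Klam, CW, G.cE4 + 1, 0⟩ Q β U μ K j ∧
      PairValueIncrementAtV5 L M G ⟨Klam, CW, G.cE4 + 1, 0⟩ Q β U μ K j := by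
    intro j hj
    rcases Nat.lt_or_ge j n with hlt | hge
    · have h := he L M G _ Q β U μ K j (hHist j hlt).2.2.1
      exact ⟨h.1, h.2.1⟩
    · have : j = n := le_antisymm hj hge
      subst this
      exact ⟨hEn.1, hEn.2.1⟩
  -- (B1-v2′) from row 0′ on the V5 engine slot, in the regime
  have hLline : 17 * ∑ j ∈ range n, Q.CL β j / L ≤ U ^ 2 := klbs_volume_line hCL hU hn hL
  have hsmall : 8 * 20 * (((∑ χ : D4Irrep, (G.abot χ + G.atop χ) + 1) +
      2 * (G.aplus * Klam ^ 2 * G.Z + G.cloc * Klam ^ 2 * (1 - (4 : ℝ) ^ (-G.θ))⁻¹ + 1) + 1 + 3 * (G.CF * Klam ^ 2) +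
        48 * (Q.CR * Klam ^ 3)) * U ^ 2) * (G.bhi * n) ≤ 1 := by
    rw [← hCrow_def]; exact klbs_noOnset_line hCrow hbhi hKL hc'
  have hB1 : PairArrayAtV2 L M ⟨Klam, CW, G.cE4 + 1, 0⟩ Q β U μ K n :=
    pairArrayAtV2_of_pairClauses_explicit L M hG hPWF hQ hU.le hUa1 hn (fun j hj => (hEall j hj).1)
      (fun j _ hj => (hEall j hj).2) hUCR hLline hsmall (by rw [hCW])
  -- the per-scale step: value line, iso endpoint line, first moments
  have hUD' : (CW' + G.CF * CW' + G.CF * Klam ^ 2) * U ≤ 1 := by rwa [hDval_def] at hUD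
  obtain ⟨hKval, harith⟩ := klbs_value_consts hCF hCW'0 hKlam hU.le hUD'
  have hB : BetaSplitAtS2 L M G ⟨Klam, CW, G.cE4 + 1, 0⟩ Q β U μ K n := by
    have hB0 : 0 ≤ 2 * |U| + (CW + klLegKappa * Q.CR * Klam ^ 3) * U ^ 2 := by
      rw [← hCW'_def]; exact add_nonneg (mul_nonneg zero_le_two (abs_nonneg U)) (mul_nonneg hCW'0 (sq_nonneg U))
    refine betaSplitAtS2_of_pairArrayAtV2 L M ⟨Klam, CW, G.cE4 + 1, 0⟩ Q hB0 hKlam0 hB1 hEn.2.2.2 hEn.2.2.1 ?_ ?_ ?_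
    · show G.CF * (2 * |U| + (CW + klLegKappa * Q.CR * Klam ^ 3) * U ^ 2) + G.CF * (Klam * U) ^ 2 ≤ Klam * |U|
      rw [hUa, ← hCW'_def]; exact harith
    · show 2 * |U| + (CW + klLegKappa * Q.CR * Klam ^ 3) * U ^ 2 ≤ Klam * |U|
      rw [hUa, ← hCW'_def]; exact hKval
    · show G.cE4 + Q.cE4 * |U| ≤ G.cE4 + 1
      linarith
  exact hs L M G _ Q β U μ K n hB

end Summit.HubbardSuperconductivity.HubbardSuperconductivity.Theorems.KLRegimeSplit

end
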